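import Mathlib
import Summits.PneNP.PneNP.Theorems.SfmBlProp7Legs
import Summits.PneNP.PneNP.Theorems.SfmBlNumerics

/-!
# Auxiliary packages for the existence theorem of the line «sfm-bl» (remainder package, part
bookkeeping, argmin form of the potential argument)

FRONTIER F-N1c; nothing here bears on P vs NP.

Definition-free helpers consumed by `SfmBlExistsCertified`:
* `sum_part_eq` / `card_part_eq` / `card_part_out_le_three` — sums and counts over the legs of one part
  `{e // p e = c}` of a leg partition versus filters over all legs;
* `min_two_part_bounds` — the potential argument of `greedy_two_part_bounds` with «`y` minimises `F`»
  in place of the greedy-path hypothesis (min ≤ average; enough for EXISTENCE);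
* `remainder_package` — Prop. 7 in the leg model (`sum_trace_pow_le_legs`) + the §6 numerics of
  `SfmBlNumerics` with the concrete constants `L = 2^60`, `γ′ = √(6000·2^60)`, `γ_sp = 60γ′`, walk
  exponent `ℓ = 2^{N+6}` and `t₀ = 2^{N+5} + N` (`N` = number of pieces): it returns the threshold `A₁`,
  the radius `r = √2·ρ_R` with `A₁ ≤ r^ℓ`, the averaged bound `Σ_T tr(A_T^ℓ) ≤ 2^m·A₁/10` and the
  remainder budget `N·r/2 ≤ 0.32·m`;
* `sum_card_parts_le` — the spots together hold at most all `3m` legs.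
-/

namespace Summit.PneNP.PneNP.Theorems.SfmBl

open Matrix Finset BigOperators
open Summit.PneNP.PneNP.Theorems.CandCutNorm

/-! ### Parts of a leg partition as subtypes -/

/-- A filtered sum over the legs of part `c` is the filtered sum over all legs with the extra conjunct. -/
theorem sum_part_eq {Λ κ : Type*} [Fintype Λ] [DecidableEq κ] (p : Λ → κ) (c : κ)
    (q : Λ → Prop) [DecidablePred q] (f : Λ → ℝ) :
    ∑ e ∈ (Finset.univ : Finset {e // p e = c}).filter (fun e => q e.1), f e.1
      = ∑ e ∈ Finset.univ.filter (fun e => q e ∧ p e = c), f e := by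
  classical
  rw [Finset.sum_filter]
  have h := Finset.sum_subtype (F := inferInstance) (Finset.univ.filter fun e => p e = c)
    (p := fun e => p e = c) (by intro x; simp) (fun e => if q e then f e else 0)
  rw [← h, ← Finset.sum_filter, Finset.filter_filter]
  refine Finset.sum_congr ?_ (fun _ _ => rfl)
  exact Finset.filter_congr fun e _ => by tauto

/-- A filtered count over the legs of part `c`. -/
theorem card_part_eq {Λ κ : Type*} [Fintype Λ] [DecidableEq κ] (p : Λ → κ) (c : κ)
    (q : Λ → Prop) [DecidablePred q] :
    ((Finset.univ : Finset {e // p e = c}).filter (fun e => q e.1)).card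
      = (Finset.univ.filter (fun e => q e ∧ p e = c)).card := by
  classical
  have h := sum_part_eq p c q (fun _ => (1 : ℝ))
  simp only [Finset.sum_const, nsmul_eq_mul, mul_one] at h
  exact_mod_cast h

/-- Two-conjunct variant in the shape `q₁ ∧ q₂ ∧ p = c` used by `bilin_le_sum_of_parts`. -/
theorem sum_part_eq₂ {Λ κ : Type*} [Fintype Λ] [DecidableEq κ] (p : Λ → κ) (c : κ)
    (q₁ q₂ : Λ → Prop) [DecidablePred q₁] [DecidablePred q₂] (f : Λ → ℝ) :
    ∑ e ∈ (Finset.univ : Finset {e // p e = c}).filter (fun e => q₁ e.1 ∧ q₂ e.1), f e.1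
      = ∑ e ∈ Finset.univ.filter (fun e => q₁ e ∧ q₂ e ∧ p e = c), f e := by
  classical
  rw [sum_part_eq p c (fun e => q₁ e ∧ q₂ e) f]
  exact Finset.sum_congr (Finset.filter_congr fun e _ => by tauto) fun _ _ => rfl

/-- Two-conjunct count variant. -/
theorem card_part_eq₂ {Λ κ : Type*} [Fintype Λ] [DecidableEq κ] (p : Λ → κ) (c : κ)
    (q₁ q₂ : Λ → Prop) [DecidablePred q₁] [DecidablePred q₂] :
    ((Finset.univ : Finset {e // p e = c}).filter (fun e => q₁ e.1 ∧ q₂ e.1)).card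
      = (Finset.univ.filter (fun e => p e = c ∧ q₁ e ∧ q₂ e)).card := by
  classical
  rw [card_part_eq p c (fun e => q₁ e ∧ q₂ e)]
  exact congrArg Finset.card (Finset.filter_congr fun e _ => by tauto)

/-- The number of legs of part `c` is the number of legs labelled `c`. -/
theorem card_part_univ {Λ κ : Type*} [Fintype Λ] [DecidableEq κ] (p : Λ → κ) (c : κ) :
    Fintype.card {e // p e = c} = (Finset.univ.filter (fun e => p e = c)).card := by
  classical
  exact Fintype.card_subtype _

/-- In the leg set `Fin m × Fin 3`, each output owns at most three legs of any part. -/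
theorem card_part_out_le_three {m : ℕ} {κ : Type*} [DecidableEq κ] (p : Fin m × Fin 3 → κ) (c : κ)
    (j : Fin m) :
    ((Finset.univ : Finset {e : Fin m × Fin 3 // p e = c}).filter (fun e => e.1.1 = j)).card ≤ 3 := by
  classical
  rw [card_part_eq p c (fun e : Fin m × Fin 3 => e.1 = j)]
  calc (Finset.univ.filter (fun e : Fin m × Fin 3 => e.1 = j ∧ p e = c)).card
      ≤ ((Finset.univ : Finset (Fin 3)).image fun l => (j, l)).card :=
        Finset.card_le_card fun e he => by
          simp only [Finset.mem_filter, Finset.mem_univ, true_and] at he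
          exact Finset.mem_image.2 ⟨e.2, Finset.mem_univ _, Prod.ext he.1.symm rfl⟩
    _ ≤ (Finset.univ : Finset (Fin 3)).card := Finset.card_image_le
    _ = 3 := by simp

/-- The parts labelled `some s` together hold at most all legs. -/
theorem sum_card_parts_le {Λ : Type*} [Fintype Λ] {r : ℕ} (p : Λ → Option (Fin r)) :
    ∑ s : Fin r, (Finset.univ.filter (fun e => p e = some s)).card ≤ Fintype.card Λ := by
  classical
  have h := Finset.sum_card_fiberwise_eq_card_filter (Finset.univ : Finset Λ)
    ((Finset.univ : Finset (Fin r)).map ⟨some, Option.some_injective _⟩) p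
  rw [Finset.sum_map] at h
  simp only [Function.Embedding.coeFn_mk] at h
  rw [h]
  exact Finset.card_le_univ _

/-! ### The potential argument, argmin form -/

/-- MIN ≤ AVERAGE form of `greedy_two_part_bounds`: if `y` minimises `F = trR/A₁ + hat/((6/5)(Q₀+1))`
and the averaged bounds hold, then `trR y < A₁` and `hat y < (6/5)(Q₀+1)`. -/
theorem min_two_part_bounds {m : ℕ} (trR hat F : (Fin m → Bool) → ℝ)
    (htr0 : ∀ T, 0 ≤ trR T) (hhat0 : ∀ T, 0 ≤ hat T) {A₁ Q₀ : ℝ} (hA₁ : 0 < A₁) (hQ₀ : 0 ≤ Q₀)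
    (hF : ∀ T, F T = trR T / A₁ + hat T / (6 / 5 * (Q₀ + 1)))
    (hsum₁ : ∑ T, trR T ≤ 2 ^ m * (A₁ / 10)) (hsum₂ : ∑ T, hat T ≤ 2 ^ m * Q₀)
    (y : Fin m → Bool) (hmin : ∀ T, F y ≤ F T) :
    trR y < A₁ ∧ hat y < 6 / 5 * (Q₀ + 1) := by
  have hA₃ : 0 < 6 / 5 * (Q₀ + 1) := by positivity
  have hsumF : ∑ T, F T < 2 ^ m * (1 : ℝ) := by
    have e1 : ∑ T, F T = (∑ T, trR T) / A₁ + (∑ T, hat T) / (6 / 5 * (Q₀ + 1)) := by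
      simp only [hF, Finset.sum_add_distrib, Finset.sum_div]
    rw [e1]
    have b1 : (∑ T, trR T) / A₁ ≤ 2 ^ m / 10 := by
      rw [div_le_iff₀ hA₁]; linarith
    have b2 : (∑ T, hat T) / (6 / 5 * (Q₀ + 1)) ≤ 2 ^ m * (Q₀ / (6 / 5 * (Q₀ + 1))) := by
      rw [mul_div_assoc', div_le_div_iff_of_pos_right hA₃]; linarith
    have b3 : Q₀ / (6 / 5 * (Q₀ + 1)) < 5 / 6 := by
      rw [div_lt_iff₀ hA₃]; linarith
    have h2m : (0 : ℝ) < 2 ^ m := by positivity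
    nlinarith
  have hcard : ((Finset.univ : Finset (Fin m → Bool)).card : ℝ) = 2 ^ m := by
    rw [Finset.card_univ, Fintype.card_fun, Fintype.card_bool, Fintype.card_fin]; push_cast; ring
  have hFy : F y < 1 := by
    have h1 : (2 : ℝ) ^ m * F y ≤ ∑ T, F T := by
      rw [← hcard, ← nsmul_eq_mul, ← Finset.sum_const]
      exact Finset.sum_le_sum fun T _ => hmin T
    have h2m : (0 : ℝ) < 2 ^ m := by positivity
    nlinarith
  rw [hF y] at hFy
  have t1 : 0 ≤ trR y / A₁ := div_nonneg (htr0 y) hA₁.le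
  have t2 : 0 ≤ hat y / (6 / 5 * (Q₀ + 1)) := div_nonneg (hhat0 y) hA₃.le
  constructor
  · have : trR y / A₁ < 1 := by linarith
    rwa [div_lt_one hA₁] at this
  · have : hat y / (6 / 5 * (Q₀ + 1)) < 1 := by linarith
    rwa [div_lt_one hA₃] at this

/-! ### The remainder package (Prop. 7 + numerics, concrete constants) -/

/-- `ρ_R ≥ 1` for the concrete constants. -/
theorem sfmBl_one_le_rho :
    (1 : ℝ) ≤ 100 * (60 * Real.sqrt (6000 * 2 ^ 60))
        * (Real.logb 2 ((2 : ℝ) ^ 60 / (60 * Real.sqrt (6000 * 2 ^ 60))) + 1) := by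
  set g : ℝ := 60 * Real.sqrt (6000 * 2 ^ 60) with hg
  set X : ℝ := Real.logb 2 ((2 : ℝ) ^ 60 / g) with hX
  have hg2 : 2 ≤ g := sfmBl_two_le_gammasp
  have hgL : g ≤ (2 : ℝ) ^ 60 := sfmBl_gammasp_le_L
  have hg0 : 0 < g := by linarith
  have hlog : 0 ≤ X := Real.logb_nonneg (by norm_num) (by rw [le_div_iff₀ hg0]; linarith)
  have h1 : 0 ≤ g * X := mul_nonneg hg0.le hlog
  have e : 100 * g * (X + 1) = 100 * (g * X) + 100 * g := by ring
  rw [e]; linarith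

/-- **REMAINDER PACKAGE.**  Legs `e : E` of the sparse remainder (`src, dst, out`; `≤ 3` legs per output;
leg-degrees `≤ 2^60`; a graph `G ⊇ legs` of degree `≤ 2^60`); stretch `2^60·n ≤ m`, `1 ≤ n`; `N = |α|+|β|`
pieces with `1 ≤ N ≤ 2n+1+6m/2^60`; UNSIGNED SPARSENESS at `γ_sp = 60√(6000·2^60)` and
`t₀ = 2^{N+5} + N`.  Then with `ℓ = 2^{(N+4)+2}` there are `r ≥ 0` and `A₁ > 0` with `A₁ ≤ r^ℓ`,
`Σ_T tr((fromBlocks 0 (M T) (M T)ᵀ 0)^ℓ) ≤ 2^m·(A₁/10)` and `N·r/2 ≤ 0.32·m`. -/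
theorem remainder_package {α β E : Type} [Fintype α] [Fintype β] [DecidableEq α] [DecidableEq β]
    [Fintype E] {m n : ℕ} (src : E → α) (dst : E → β) (out : E → Fin m)
    (hout : ∀ j : Fin m, (Finset.univ.filter fun e => out e = j).card ≤ 3)
    (hdeg₁ : ∀ i, (Finset.univ.filter fun e => src e = i).card ≤ 2 ^ 60)
    (hdeg₂ : ∀ k, (Finset.univ.filter fun e => dst e = k).card ≤ 2 ^ 60)
    (G : SimpleGraph (α ⊕ β)) [DecidableRel G.Adj] (hG : ∀ e, G.Adj (Sum.inl (src e)) (Sum.inr (dst e)))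
    (hGdeg : ∀ x, G.degree x ≤ 2 ^ 60)
    (hn : 1 ≤ n) (hm : 2 ^ 60 * n ≤ m)
    (hN1 : 1 ≤ Fintype.card α + Fintype.card β)
    (hN : ((Fintype.card α : ℝ) + Fintype.card β) ≤ 2 * n + 1 + 6 * m / 2 ^ 60)
    (hsparse : ∀ (W₁ : Finset α) (W₂ : Finset β),
      (G.induce {x | Sum.elim (fun i => i ∈ W₁) (fun j => j ∈ W₂) x}).Connected →
      W₁.card + W₂.card ≤ 2 ^ (Fintype.card α + Fintype.card β + 5) + (Fintype.card α + Fintype.card β) →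
      ((Finset.univ.filter fun e => src e ∈ W₁ ∧ dst e ∈ W₂).card : ℝ)
        ≤ (60 * Real.sqrt (6000 * 2 ^ 60)) * Real.sqrt ((W₁.card : ℝ) * (W₂.card : ℝ)))
    (M : (Fin m → Bool) → Matrix α β ℝ)
    (hM : ∀ T i k, M T i k = ∑ e ∈ Finset.univ.filter (fun e => src e = i ∧ dst e = k),
      ((boolSign (T (out e)) : ℤ) : ℝ)) :
    ∃ rr A₁ : ℝ, 0 ≤ rr ∧ 0 < A₁ ∧ A₁ ≤ rr ^ (2 ^ ((Fintype.card α + Fintype.card β + 4) + 2)) ∧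
      (∑ T : Fin m → Bool, ((Matrix.fromBlocks (0 : Matrix α α ℝ) (M T) (M T)ᵀ (0 : Matrix β β ℝ))
          ^ (2 ^ ((Fintype.card α + Fintype.card β + 4) + 2))).trace ≤ 2 ^ m * (A₁ / 10)) ∧
      ((Fintype.card α : ℝ) + Fintype.card β) * rr / 2 ≤ 0.32 * m := by
  classical
  -- names for the constants
  set N : ℕ := Fintype.card α + Fintype.card β with hNdef
  have hL2 : (2 : ℝ) ≤ (2 : ℝ) ^ 60 := by norm_num
  have hL0 : (0 : ℝ) < (2 : ℝ) ^ 60 := by positivity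
  have hγ'0 : 0 ≤ Real.sqrt (6000 * 2 ^ 60) := Real.sqrt_nonneg _
  have hγ'L := sfmBl_gamma'_sq_ge
  have hγγ := sfmBl_gamma'_le_gammasp
  have hγsp0 : 0 < 60 * Real.sqrt (6000 * 2 ^ 60) := lt_of_lt_of_le (by norm_num) sfmBl_two_le_gammasp
  have hγspL := sfmBl_gammasp_le_L
  have hρL := sfmBl_rho_le
  have hρ1 := sfmBl_one_le_rho
  set ρ : ℝ := 100 * ((60 * Real.sqrt (6000 * 2 ^ 60))
      * (Real.logb 2 ((2 : ℝ) ^ 60 / (60 * Real.sqrt (6000 * 2 ^ 60))) + 1)) with hρdef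
  have hρL' : ρ ≤ (2 : ℝ) ^ 60 / 20 := by rw [hρdef]; linarith
  have hρ1' : 1 ≤ ρ := by rw [hρdef]; linarith
  have hρ0 : 0 ≤ ρ := by linarith
  set k : ℕ := 2 ^ (N + 5) with hkdef
  -- Prop. 7 in the leg model
  have hL₀ : ((2 ^ 60 : ℕ) : ℝ) ≤ (2 : ℝ) ^ 60 := by norm_num
  have h7 := sum_trace_pow_le_legs src dst out hout hdeg₁ hdeg₂ hL2 hL₀ G hG hGdeg hL₀ hγ'0 hγ'L hγγ
    hγsp0 hγspL (k + N) hsparse M hM k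
  rw [← hρdef] at h7
  -- the numerics
  have hNreal : (N : ℝ) = (Fintype.card α : ℝ) + Fintype.card β := by rw [hNdef]; push_cast; ring
  have hN0 : (0 : ℝ) ≤ N := Nat.cast_nonneg _
  have hNb : (N : ℝ) ≤ 2 ^ N := by exact_mod_cast (Nat.lt_two_pow_self).le
  have ht : 2 * k + 2 * N ≤ 10 * (k + N + 1) := by omega
  have hjunk := four_N_sq_pow_mul_inv_le_one hL2 hN0 hNb ht
  have hkN : 20 * (N : ℝ) ≤ 2 ^ k := by
    have h1 : (N : ℝ) + 5 ≤ 2 ^ (N + 5) := by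
      have := (Nat.lt_two_pow_self (n := N + 5)).le
      exact_mod_cast this
    have h2 : ((2 : ℝ) ^ (N + 5) : ℝ) ≤ 2 ^ k := by
      rw [hkdef]
      exact_mod_cast Nat.pow_le_pow_right (by norm_num) (Nat.lt_two_pow_self).le
    have h3 : (20 : ℝ) * N ≤ 2 ^ (N + 5) := by
      rw [pow_add]; nlinarith [show (32 : ℝ) = 2 ^ 5 by norm_num, hNb]
    linarith
  have h20 := twenty_N_pow_le hρ0 hkN
  -- the two outputs
  refine ⟨Real.sqrt 2 * ρ, 10 * (N * ρ ^ (2 * k) + 1), by positivity, by positivity, ?_, ?_, ?_⟩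
  · -- `A₁ ≤ r^ℓ`
    have hℓ : 2 ^ ((Fintype.card α + Fintype.card β + 4) + 2) = 2 * k := by
      rw [hkdef, hNdef, pow_succ]; ring
    rw [hℓ]
    have hN1' : (1 : ℝ) ≤ N := by exact_mod_cast hN1
    have hNρ : 1 ≤ (N : ℝ) * ρ ^ (2 * k) := by
      have : (1 : ℝ) ≤ ρ ^ (2 * k) := one_le_pow₀ hρ1'
      nlinarith
    linarith
  · -- the averaged trace bound
    have hℓ : 2 ^ ((Fintype.card α + Fintype.card β + 4) + 2) = 2 * k := by
      rw [hkdef, hNdef, pow_succ]; ring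
    rw [hℓ]
    refine h7.trans ?_
    rw [← hNreal]
    have h2m : (0 : ℝ) ≤ 2 ^ m := by positivity
    have hj2 := mul_le_mul_of_nonneg_left hjunk h2m
    have e : (2 : ℝ) ^ m * (10 * ((N : ℝ) * ρ ^ (2 * k) + 1) / 10)
        = 2 ^ m * ((N : ℝ) * ρ ^ (2 * k)) + 2 ^ m * 1 := by ring
    rw [e]
    linarith
  · -- the remainder budget
    have hn' : (2 : ℝ) ^ 60 * n ≤ m := by exact_mod_cast hm
    rw [← hNreal]
    exact remainder_budget_le hL0 hn hn' hρL' hN0 (by rw [hNreal]; exact hN)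

end Summit.PneNP.PneNP.Theorems.SfmBl
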